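import Summits.Parity.GeneralizedHardyLittlewood.Theorems.PrimeLevelFamEdgeMomentsBeyondDiagonalDiagCornerAbelPow
import Summits.Parity.GeneralizedHardyLittlewood.Theorems.BeyondDiagonalBeatsQuarter.CornerAssembly
import HarnessLib

/-!
# Route `PrimeLevelFamEdge`, crux K_A `MomentsBeyondDiagonal` (stmt-Parity-20007), line «petersson_layers» v4, stub `stub_diag`:
# **the corner of a general profile as a weighted family of double sums, and their estimate**

Census item G7 (corner negligible for a general admissible profile), part 2 (generalising K_B's `CornerAssembly`
from `x = xsq M` to the profile coefficients `x_m = μ(m)ψ(m)⁻¹P(log(M/m)/log M)`):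

* `tau_mul_xP_div` — `τ(k)·x_{nk}/(nk) = W(n)·a_n(k)·P(log((M/n)/k)/log M)` (`a_n = copTauW n`);
* `corner_profile_eq_sum` — **`Σ_{a,b≤M} x_a x_b (K_true(Q;a,b) − K_{log Q}(a,b)) =
  Σ_{c≤M}Σ_{d≤M/c} μ(d)·c·W(cd)²·U_P(cd,d)`**, `U_P(n,d) = Σ_{k₁,k₂≤M/n} a_n(k₁)a_n(k₂)P(ℓ⁺(k₁)/L)P(ℓ⁺(k₂)/L)E(d²k₁k₂/Q²)`
  (`quadForm_hKernel_eq` for a general coefficient vector);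
* `sum_abs_copTauW_mul_ellp_pow_le` — `Σ_{k≤Y}|a_n(k)|ℓ⁺(k)^m ≤ log^mY(1+log Y)²`;
* `abs_cornerUProfile_le` — for `P₀ = 0`: **`|U_P(n,d)| ≤ D(n)·2(1+log(M/n))²·(C₁√(2(d/Q)²K₁M/n) +
  2C₂(1+log K₁)⁻¹²(𝒲(1)+2+|log(d²/Q²)|+2log(M/n)))`** with `C₁, C₂` depending on `P` only — expand
  `P(ℓ⁺/L) = Σ_i P_iℓ⁺ⁱ/Lⁱ`, apply `abs_doubleSum_cornerE_pow_le` to each `(i,j)` and use `ℓ⁺ ≤ log(M/n) ≤ L`.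

Def-free; theorems only. Helper `--supports stmt-Parity-20007`; closes nothing; K_A, K_B and the Parity summit are NOT
proved; nothing about Landau–Siegel zeros.

## References
* E. Kowalski, P. Michel, J. VanderKam, J. reine angew. Math. 526 (2000), (21)–(23) pp. 12–13, Prop. 5.1 p. 18.
  [cite: KowalskiMichelVanderKam2000, Prop. 5.1 — derivation (corner of the diagonal, general profile)]
-/

noncomputable section

open scoped Real ArithmeticFunction.Moebius
open Finset ArithmeticFunction Polynomial

namespace Summit.Parity.GeneralizedHardyLittlewood.Theorems.MomentsBeyondDiagonal.DiagCorner

open Literature.NumberTheory.LFunctions Literature.NumberTheory.LFunctions.KMV2000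
open MollifierMainTerm (W)
open Literature.Barriers.Parity (Icc_one_eq_Ioc_zero)
open Summit.Parity.GeneralizedHardyLittlewood.Theorems.BeyondDiagonalBeatsQuarter.KernelFormXSq
  (copTauW copTauW_apply divWeight divWeight_nonneg abs_W_le W_apply'' isMultiplicative_W' W_eq_zero_of_not_squarefree)
open Summit.Parity.GeneralizedHardyLittlewood.Theorems.BeyondDiagonalBeatsQuarter.Corner

/-! ### The profile coefficients in Selberg coordinates -/

/-- `τ(k)·x_{nk}/(nk) = W(n)·a_n(k)·P(log((M/n)/k)/log M)` for `x_m = μ(m)ψ(m)⁻¹P(log(M/m)/log M)`, `n, k ≥ 1`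
(`W(nk) = W(n)W(k)` for `(n,k) = 1`, `= 0` otherwise). [cite: KowalskiMichelVanderKam2000, (23) — derivation] -/
theorem tau_mul_xP_div (P : ℝ[X]) (M : ℝ) {n k : ℕ} (hn : n ≠ 0) (hk : k ≠ 0) :
    (k.divisors.card : ℝ) * (((μ (n * k) : ℝ) * ((psi (n * k))⁻¹ *
        P.eval (Real.log (M / ((n * k : ℕ) : ℝ)) / Real.log M))) / ((n * k : ℕ) : ℝ)) =
      W n * (copTauW n k * P.eval (Real.log (M / n / k) / Real.log M)) := by
  rw [copTauW_apply]
  have hW : ((μ (n * k) : ℝ) * ((psi (n * k))⁻¹ *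
      P.eval (Real.log (M / ((n * k : ℕ) : ℝ)) / Real.log M))) / ((n * k : ℕ) : ℝ) =
      W (n * k) * P.eval (Real.log (M / ((n * k : ℕ) : ℝ)) / Real.log M) := by
    rw [W_apply'' (mul_ne_zero hn hk)]
    have : ((n * k : ℕ) : ℝ) ≠ 0 := by exact_mod_cast mul_ne_zero hn hk
    field_simp
  rw [hW]
  have hlog : Real.log (M / ((n * k : ℕ) : ℝ)) = Real.log (M / n / k) := by
    push_cast; rw [div_div]
  rw [hlog]
  by_cases hc : k.Coprime n
  · rw [if_pos hc, isMultiplicative_W'.map_mul_of_coprime hc.symm]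
    ring
  · rw [if_neg hc]
    have hns : ¬ Squarefree (n * k) := fun h ↦ hc (Nat.coprime_of_squarefree_mul h).symm
    rw [W_eq_zero_of_not_squarefree hns]
    ring

/-- **The corner of a general profile as a weighted family of double sums**: for `M ≥ 1`, `Q > 0`,
`x_m = μ(m)ψ(m)⁻¹P(log(M/m)/log M)`:
`Σ_{a,b≤M} x_a x_b (K_true(Q;a,b) − kmvKernel(log Q;a,b)) = Σ_{c≤M}Σ_{d≤M/c} μ(d)·c·W(cd)²·U_P(cd,d)`,
`U_P(n,d) = Σ_{k₁,k₂≤M/n} a_n(k₁)a_n(k₂)·P(ℓ⁺(k₁)/log M)P(ℓ⁺(k₂)/log M)·E(d²k₁k₂/Q²)`.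
[cite: KowalskiMichelVanderKam2000, (21)–(23), Prop. 5.1 — derivation (corner of the diagonal, general profile)] -/
theorem corner_profile_eq_sum (P : ℝ[X]) {M Q : ℝ} (hM : 1 ≤ M) (hQ : 0 < Q) :
    ∑ a ∈ Icc 1 ⌊M⌋₊, ∑ b ∈ Icc 1 ⌊M⌋₊,
        ((μ a : ℝ) * ((psi a)⁻¹ * P.eval (Real.log (M / a) / Real.log M))) *
          ((μ b : ℝ) * ((psi b)⁻¹ * P.eval (Real.log (M / b) / Real.log M))) *
          (trueDiagKernel Q a b - kmvKernel (Real.log Q) a b) =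
      ∑ c ∈ Icc 1 ⌊M⌋₊, ∑ d ∈ Icc 1 (⌊M⌋₊ / c), (μ d : ℝ) * c * W (c * d) ^ 2 *
        ∑ k₁ ∈ Icc 1 ⌊M / ((c * d : ℕ) : ℝ)⌋₊, ∑ k₂ ∈ Icc 1 ⌊M / ((c * d : ℕ) : ℝ)⌋₊,
          copTauW (c * d) k₁ * copTauW (c * d) k₂ *
            P.eval (ellp (M / ((c * d : ℕ) : ℝ)) k₁ / Real.log M) *
              P.eval (ellp (M / ((c * d : ℕ) : ℝ)) k₂ / Real.log M) *
                cornerE ((d : ℝ) ^ 2 / Q ^ 2 * k₁ * k₂) := by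
  have hM0 : 0 ≤ M := by linarith
  set x : ℕ → ℝ := fun m ↦ (μ m : ℝ) * ((psi m)⁻¹ * P.eval (Real.log (M / m) / Real.log M)) with hx
  have h1 : ∑ a ∈ Icc 1 ⌊M⌋₊, ∑ b ∈ Icc 1 ⌊M⌋₊,
      x a * x b * (trueDiagKernel Q a b - kmvKernel (Real.log Q) a b) =
      ∑ a ∈ Icc 1 ⌊M⌋₊, ∑ b ∈ Icc 1 ⌊M⌋₊, x a * x b * hKernel cornerE Q a b := by
    refine Finset.sum_congr rfl fun a ha ↦ Finset.sum_congr rfl fun b hb ↦ ?_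
    have ha0 : a ≠ 0 := by have := (Finset.mem_Icc.1 ha).1; omega
    have hb0 : b ≠ 0 := by have := (Finset.mem_Icc.1 hb).1; omega
    rw [trueDiagKernel_sub_kmvKernel hQ ha0 hb0]
  simp only [hx] at h1
  rw [h1, quadForm_hKernel_eq]
  refine Finset.sum_congr rfl fun c hc ↦ Finset.sum_congr rfl fun d hd ↦ ?_
  have hc0 : c ≠ 0 := by have := (Finset.mem_Icc.1 hc).1; omega
  have hd0 : d ≠ 0 := by have := (Finset.mem_Icc.1 hd).1; omega
  have hn0 : c * d ≠ 0 := mul_ne_zero hc0 hd0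
  have hfloor : ⌊M⌋₊ / (c * d) = ⌊M / ((c * d : ℕ) : ℝ)⌋₊ := (Nat.floor_div_natCast M (c * d)).symm
  rw [hfloor, Finset.mul_sum, Finset.mul_sum]
  refine Finset.sum_congr rfl fun k₁ hk₁ ↦ ?_
  rw [Finset.mul_sum, Finset.mul_sum]
  refine Finset.sum_congr rfl fun k₂ hk₂ ↦ ?_
  have hk₁0 : k₁ ≠ 0 := by have := (Finset.mem_Icc.1 hk₁).1; omega
  have hk₂0 : k₂ ≠ 0 := by have := (Finset.mem_Icc.1 hk₂).1; omega
  rw [tau_mul_xP_div P M hn0 hk₁0, tau_mul_xP_div P M hn0 hk₂0]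
  have hY : 0 ≤ M / ((c * d : ℕ) : ℝ) := by positivity
  rw [ellp_eq_log hY hk₁, ellp_eq_log hY hk₂]
  have hE : cornerE ((d : ℝ) ^ 2 * k₁ * k₂ / Q ^ 2) = cornerE ((d : ℝ) ^ 2 / Q ^ 2 * k₁ * k₂) := by
    congr 1; ring
  rw [hE]
  push_cast
  ring

/-! ### The estimate for the profile double sums -/

/-- `Σ_{k ≤ Y} |a_n(k)|·ℓ⁺(k)^m ≤ log^mY·(1 + log Y)²` (`|a_n(k)| ≤ τ(k)/k`, `Σ_{k≤Y} τ(k)/k ≤ (1+log Y)²`).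
[folklore] -/
theorem sum_abs_copTauW_mul_ellp_pow_le (n m : ℕ) {Y : ℝ} (hY : 1 ≤ Y) :
    ∑ k ∈ Icc 1 ⌊Y⌋₊, |copTauW n k| * ellp Y k ^ m ≤ Real.log Y ^ m * (1 + Real.log Y) ^ 2 := by
  have hY0 : 0 < Y := by linarith
  have hLY : 0 ≤ Real.log Y := Real.log_nonneg hY
  have h1 : ∀ k ∈ Icc 1 ⌊Y⌋₊, |copTauW n k| * ellp Y k ^ m ≤
      (k.divisors.card : ℝ) / k * Real.log Y ^ m := by
    intro k hk
    have hk1 := (Finset.mem_Icc.1 hk).1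
    have habs : |copTauW n k| ≤ (k.divisors.card : ℝ) / k := by
      rw [copTauW_apply]
      split_ifs
      · rw [abs_mul, abs_of_nonneg (by positivity : (0 : ℝ) ≤ k.divisors.card), div_eq_mul_inv]
        exact mul_le_mul_of_nonneg_left (abs_W_le k) (by positivity)
      · rw [abs_zero]; positivity
    have hl : ellp Y k ^ m ≤ Real.log Y ^ m :=
      pow_le_pow_left₀ (ellp_nonneg Y k) (ellp_le_log hY hk1) m
    exact mul_le_mul habs hl (pow_nonneg (ellp_nonneg Y k) m) (by positivity)
  refine (Finset.sum_le_sum h1).trans ?_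
  rw [← Finset.sum_mul]
  have h2 : ∑ k ∈ Icc 1 ⌊Y⌋₊, (k.divisors.card : ℝ) / k ≤ (1 + Real.log ⌊Y⌋₊) ^ 2 := by
    rw [Icc_one_eq_Ioc_zero]
    exact Literature.NumberTheory.Sieve.Vaughan.sum_card_divisors_div_le ⌊Y⌋₊
  have h3 : (1 + Real.log ⌊Y⌋₊) ^ 2 ≤ (1 + Real.log Y) ^ 2 := by
    have hf1 : (1 : ℝ) ≤ ⌊Y⌋₊ := by exact_mod_cast Nat.le_floor (by simpa using hY)
    have : Real.log (⌊Y⌋₊ : ℝ) ≤ Real.log Y := Real.log_le_log (by linarith) (Nat.floor_le hY0.le)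
    have : 0 ≤ Real.log (⌊Y⌋₊ : ℝ) := Real.log_nonneg hf1
    nlinarith
  calc (∑ k ∈ Icc 1 ⌊Y⌋₊, (k.divisors.card : ℝ) / k) * Real.log Y ^ m
      ≤ (1 + Real.log Y) ^ 2 * Real.log Y ^ m :=
        mul_le_mul_of_nonneg_right (h2.trans h3) (pow_nonneg hLY m)
    _ = Real.log Y ^ m * (1 + Real.log Y) ^ 2 := by ring

/-- **The estimate for the profile double sums.** For a real polynomial `P` with `P₀ = 0` there are `C₁, C₂ > 0`
(depending on `P`) such that for every `n ≥ 1`, `d ≥ 1`, `Q > 0`, `M > 1` with `n ≤ M` and every threshold `K₁`: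
`|U_P(n,d)| ≤ D(n)·2(1+log Y)²·(C₁√(2(d/Q)²K₁Y) + 2C₂(1+log K₁)⁻¹²(𝒲(1)+2+|log(d²/Q²)|+2log Y))`, `Y = M/n`
(expand `P(ℓ⁺/log M)`, `abs_doubleSum_cornerE_pow_le` per pair of exponents with `B = C·D(n)`,
`η = C·D(n)(1+log K₁)⁻¹²` from K_B's `CornerMoebius`, and `ℓ⁺ ≤ log Y ≤ log M`).
[cite: KowalskiMichelVanderKam2000, Prop. 5.1 — derivation (corner double sums, general profile)] -/
theorem abs_cornerUProfile_le (P : ℝ[X]) (hP0 : P.coeff 0 = 0) :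
    ∃ C₁ C₂ : ℝ, 0 < C₁ ∧ 0 < C₂ ∧ ∀ (n : ℕ), n ≠ 0 → ∀ (d : ℕ), d ≠ 0 → ∀ (Q M : ℝ), 0 < Q → 1 < M →
      (n : ℝ) ≤ M → ∀ K₁ : ℕ,
      |∑ k₁ ∈ Icc 1 ⌊M / n⌋₊, ∑ k₂ ∈ Icc 1 ⌊M / n⌋₊,
          copTauW n k₁ * copTauW n k₂ *
            P.eval (ellp (M / n) k₁ / Real.log M) * P.eval (ellp (M / n) k₂ / Real.log M) *
              cornerE ((d : ℝ) ^ 2 / Q ^ 2 * k₁ * k₂)| ≤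
        divWeight n * (2 * (1 + Real.log (M / n)) ^ 2) *
          (C₁ * Real.sqrt (2 * ((d : ℝ) ^ 2 / Q ^ 2) * K₁ * (M / n)) +
            2 * (C₂ / (1 + Real.log K₁) ^ 12) *
              (scriptW 1 + 2 + |Real.log ((d : ℝ) ^ 2 / Q ^ 2)| + 2 * Real.log (M / n))) := by
  obtain ⟨C₁, hC₁, hB⟩ := abs_sum_copTauW_le'
  obtain ⟨C₂, hC₂, hA⟩ := abs_sum_copTauW_le
  set R := Finset.range (P.natDegree + 1) with hR
  set SP : ℝ := ∑ i ∈ R, |P.coeff i| with hSP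
  have hSP0 : 0 ≤ SP := Finset.sum_nonneg fun i _ ↦ abs_nonneg _
  refine ⟨C₁ * (SP ^ 2 + 1), C₂ * (SP ^ 2 + 1), by positivity, by positivity,
    fun n hn d hd Q M hQ hM1 hnM K₁ ↦ ?_⟩
  have hn0 : (0 : ℝ) < n := by exact_mod_cast Nat.pos_of_ne_zero hn
  set Y : ℝ := M / n with hYdef
  set L : ℝ := Real.log M with hLdef
  have hL0 : 0 < L := Real.log_pos hM1
  have hY : 1 ≤ Y := by rw [hYdef, le_div_iff₀ hn0]; linarith
  have hYM : Y ≤ M := div_le_self (by linarith) (by exact_mod_cast Nat.one_le_iff_ne_zero.2 hn)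
  have hLY0 : 0 ≤ Real.log Y := Real.log_nonneg hY
  have hLYL : Real.log Y ≤ L := Real.log_le_log (by linarith) hYM
  have hratio : Real.log Y / L ≤ 1 := (div_le_one hL0).2 hLYL
  have hratio0 : 0 ≤ Real.log Y / L := div_nonneg hLY0 hL0.le
  have hα : 0 < (d : ℝ) ^ 2 / Q ^ 2 := by
    have : (0 : ℝ) < d := by exact_mod_cast Nat.pos_of_ne_zero hd
    positivity
  have hD := divWeight_nonneg n
  set N : ℕ := ⌊Y⌋₊ with hN
  set G : ℝ := scriptW 1 + 2 + |Real.log ((d : ℝ) ^ 2 / Q ^ 2)| + 2 * Real.log Y with hGdef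
  have hW : 0 ≤ scriptW 1 := scriptW_nonneg zero_le_one
  have hG0 : 0 ≤ G := by rw [hGdef]; positivity
  have hK0 : 0 ≤ Real.log (K₁ : ℝ) := Real.log_natCast_nonneg K₁
  -- partial-sum inputs
  have hBe : ∀ e : ℕ, |∑ k ∈ Icc 1 e, copTauW n k| ≤ C₁ * divWeight n := by
    intro e
    rcases Nat.eq_zero_or_pos e with rfl | he
    · simp only [show Icc (1 : ℕ) 0 = ∅ from Finset.Icc_eq_empty (by norm_num), Finset.sum_empty, abs_zero]
      positivity
    · have := hB n hn (e : ℝ) (by exact_mod_cast he)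
      rwa [Nat.floor_natCast] at this
  have hηe : ∀ e : ℕ, K₁ ≤ e → |∑ k ∈ Icc 1 e, copTauW n k| ≤ C₂ / (1 + Real.log K₁) ^ 12 * divWeight n := by
    intro e he
    rcases Nat.eq_zero_or_pos e with rfl | he0
    · simp only [show Icc (1 : ℕ) 0 = ∅ from Finset.Icc_eq_empty (by norm_num), Finset.sum_empty, abs_zero]
      positivity
    · have h := hA n hn (e : ℝ) (by exact_mod_cast he0)
      rw [Nat.floor_natCast] at h
      refine h.trans ?_
      have hle : Real.log (K₁ : ℝ) ≤ Real.log (e : ℝ) := by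
        rcases Nat.eq_zero_or_pos K₁ with rfl | hK0'
        · simp only [Nat.cast_zero, Real.log_zero]; exact Real.log_natCast_nonneg e
        · exact Real.log_le_log (by exact_mod_cast hK0') (by exact_mod_cast he)
      calc C₂ * divWeight n / (1 + Real.log (e : ℝ)) ^ 12
          = C₂ / (1 + Real.log (e : ℝ)) ^ 12 * divWeight n := by ring
        _ ≤ C₂ / (1 + Real.log (K₁ : ℝ)) ^ 12 * divWeight n := by
            apply mul_le_mul_of_nonneg_right _ hD
            apply div_le_div_of_nonneg_left hC₂.le (by positivity)
            exact pow_le_pow_left₀ (by positivity) (by linarith) 12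
  -- the per-exponent estimate, `i, j ≥ 1`
  set br : ℝ := C₁ * Real.sqrt (2 * ((d : ℝ) ^ 2 / Q ^ 2) * K₁ * Y) + 2 * (C₂ / (1 + Real.log K₁) ^ 12) * G
    with hbr
  have hbr0 : 0 ≤ br := by rw [hbr]; positivity
  have hij : ∀ i j : ℕ, 1 ≤ i → 1 ≤ j →
      |∑ k₁ ∈ Icc 1 N, ∑ k₂ ∈ Icc 1 N, copTauW n k₁ * copTauW n k₂ * ellp Y k₁ ^ i * ellp Y k₂ ^ j *
          cornerE ((d : ℝ) ^ 2 / Q ^ 2 * k₁ * k₂)| ≤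
        divWeight n * (2 * Real.log Y ^ (i + j) * (1 + Real.log Y) ^ 2) * br := by
    intro i j hi hj
    have h := abs_doubleSum_cornerE_pow_le (a := fun k ↦ copTauW n k) (K₁ := K₁) hY hα hi hj hBe hηe
    refine h.trans ?_
    have hSi := sum_abs_copTauW_mul_ellp_pow_le n i hY
    have hSj := sum_abs_copTauW_mul_ellp_pow_le n j hY
    rw [← hN] at hSi hSj
    have hpos1 : 0 ≤ C₁ * divWeight n * (2 * Real.log Y ^ j * Real.sqrt (2 * ((d : ℝ) ^ 2 / Q ^ 2) * K₁ * Y)) := by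
      positivity
    have hpos2 : 0 ≤ 2 * (C₂ / (1 + Real.log K₁) ^ 12 * divWeight n) * (2 * Real.log Y ^ i * G) := by
      positivity
    calc (∑ k ∈ Icc 1 N, |copTauW n k| * ellp Y k ^ i) *
          (C₁ * divWeight n * (2 * Real.log Y ^ j * Real.sqrt (2 * ((d : ℝ) ^ 2 / Q ^ 2) * K₁ * Y))) +
          (∑ k ∈ Icc 1 N, |copTauW n k| * ellp Y k ^ j) *
            (2 * (C₂ / (1 + Real.log K₁) ^ 12 * divWeight n) * (2 * Real.log Y ^ i * G))
        ≤ (Real.log Y ^ i * (1 + Real.log Y) ^ 2) *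
          (C₁ * divWeight n * (2 * Real.log Y ^ j * Real.sqrt (2 * ((d : ℝ) ^ 2 / Q ^ 2) * K₁ * Y))) +
          (Real.log Y ^ j * (1 + Real.log Y) ^ 2) *
            (2 * (C₂ / (1 + Real.log K₁) ^ 12 * divWeight n) * (2 * Real.log Y ^ i * G)) :=
          add_le_add (mul_le_mul_of_nonneg_right hSi hpos1) (mul_le_mul_of_nonneg_right hSj hpos2)
      _ = divWeight n * (2 * Real.log Y ^ (i + j) * (1 + Real.log Y) ^ 2) * br := by
          rw [hbr, pow_add]; ring
  -- expand the profile weights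
  have hexp : ∀ k₁ k₂ : ℕ, copTauW n k₁ * copTauW n k₂ *
      P.eval (ellp Y k₁ / L) * P.eval (ellp Y k₂ / L) * cornerE ((d : ℝ) ^ 2 / Q ^ 2 * k₁ * k₂) =
      ∑ i ∈ R, ∑ j ∈ R, P.coeff i / L ^ i * (P.coeff j / L ^ j) *
        (copTauW n k₁ * copTauW n k₂ * ellp Y k₁ ^ i * ellp Y k₂ ^ j *
          cornerE ((d : ℝ) ^ 2 / Q ^ 2 * k₁ * k₂)) := by
    intro k₁ k₂
    rw [Polynomial.eval_eq_sum_range, Polynomial.eval_eq_sum_range]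
    simp only [← hR, div_pow]
    rw [show ∀ a e : ℝ, ∀ s t : ℝ, a * s * t * e = a * e * (s * t) from fun a e s t ↦ by ring,
      Finset.sum_mul_sum, Finset.mul_sum]
    refine Finset.sum_congr rfl fun i _ ↦ ?_
    rw [Finset.mul_sum]
    refine Finset.sum_congr rfl fun j _ ↦ ?_
    ring
  have hswap : ∑ k₁ ∈ Icc 1 N, ∑ k₂ ∈ Icc 1 N, copTauW n k₁ * copTauW n k₂ *
      P.eval (ellp Y k₁ / L) * P.eval (ellp Y k₂ / L) * cornerE ((d : ℝ) ^ 2 / Q ^ 2 * k₁ * k₂) =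
      ∑ i ∈ R, ∑ j ∈ R, P.coeff i / L ^ i * (P.coeff j / L ^ j) *
        ∑ k₁ ∈ Icc 1 N, ∑ k₂ ∈ Icc 1 N, copTauW n k₁ * copTauW n k₂ * ellp Y k₁ ^ i * ellp Y k₂ ^ j *
          cornerE ((d : ℝ) ^ 2 / Q ^ 2 * k₁ * k₂) := by
    rw [Finset.sum_congr rfl fun k₁ _ ↦ Finset.sum_congr rfl fun k₂ _ ↦ hexp k₁ k₂]
    rw [Finset.sum_congr rfl fun k₁ _ ↦ Finset.sum_comm, Finset.sum_comm]
    refine Finset.sum_congr rfl fun i _ ↦ ?_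
    rw [Finset.sum_congr rfl fun k₁ _ ↦ Finset.sum_comm, Finset.sum_comm]
    refine Finset.sum_congr rfl fun j _ ↦ ?_
    rw [Finset.mul_sum]
    refine Finset.sum_congr rfl fun k₁ _ ↦ ?_
    rw [Finset.mul_sum]
  rw [hswap]
  -- bound term by term; the orders `i = 0` or `j = 0` vanish (`P₀ = 0`)
  have hterm : ∀ i ∈ R, ∀ j ∈ R, |P.coeff i / L ^ i * (P.coeff j / L ^ j) *
      ∑ k₁ ∈ Icc 1 N, ∑ k₂ ∈ Icc 1 N, copTauW n k₁ * copTauW n k₂ * ellp Y k₁ ^ i * ellp Y k₂ ^ j *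
        cornerE ((d : ℝ) ^ 2 / Q ^ 2 * k₁ * k₂)| ≤
      |P.coeff i| * |P.coeff j| * (divWeight n * (2 * (1 + Real.log Y) ^ 2) * br) := by
    intro i _ j _
    rcases Nat.eq_zero_or_pos i with rfl | hi
    · rw [hP0]; simp
    rcases Nat.eq_zero_or_pos j with rfl | hj
    · rw [hP0]; simp
    rw [abs_mul, abs_mul, abs_div, abs_div, abs_of_pos (pow_pos hL0 i), abs_of_pos (pow_pos hL0 j)]
    have h := hij i j hi hj
    have hpow : Real.log Y ^ (i + j) / (L ^ i * L ^ j) ≤ 1 := by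
      rw [← pow_add, ← div_pow]
      exact pow_le_one₀ hratio0 hratio
    calc |P.coeff i| / L ^ i * (|P.coeff j| / L ^ j) *
          |∑ k₁ ∈ Icc 1 N, ∑ k₂ ∈ Icc 1 N, copTauW n k₁ * copTauW n k₂ * ellp Y k₁ ^ i * ellp Y k₂ ^ j *
            cornerE ((d : ℝ) ^ 2 / Q ^ 2 * k₁ * k₂)|
        ≤ |P.coeff i| / L ^ i * (|P.coeff j| / L ^ j) *
            (divWeight n * (2 * Real.log Y ^ (i + j) * (1 + Real.log Y) ^ 2) * br) :=
          mul_le_mul_of_nonneg_left h (by positivity)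
      _ = |P.coeff i| * |P.coeff j| * (divWeight n * (2 * (1 + Real.log Y) ^ 2) * br) *
            (Real.log Y ^ (i + j) / (L ^ i * L ^ j)) := by
          field_simp
      _ ≤ |P.coeff i| * |P.coeff j| * (divWeight n * (2 * (1 + Real.log Y) ^ 2) * br) * 1 := by
          gcongr
      _ = _ := mul_one _
  calc |∑ i ∈ R, ∑ j ∈ R, P.coeff i / L ^ i * (P.coeff j / L ^ j) *
        ∑ k₁ ∈ Icc 1 N, ∑ k₂ ∈ Icc 1 N, copTauW n k₁ * copTauW n k₂ * ellp Y k₁ ^ i * ellp Y k₂ ^ j *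
          cornerE ((d : ℝ) ^ 2 / Q ^ 2 * k₁ * k₂)|
      ≤ ∑ i ∈ R, ∑ j ∈ R, |P.coeff i| * |P.coeff j| * (divWeight n * (2 * (1 + Real.log Y) ^ 2) * br) := by
        refine (Finset.abs_sum_le_sum_abs _ _).trans (Finset.sum_le_sum fun i hi ↦ ?_)
        exact (Finset.abs_sum_le_sum_abs _ _).trans (Finset.sum_le_sum fun j hj ↦ hterm i hi j hj)
    _ = SP * SP * (divWeight n * (2 * (1 + Real.log Y) ^ 2) * br) := by
        rw [hSP, Finset.sum_mul_sum, Finset.sum_mul]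
        refine Finset.sum_congr rfl fun i _ ↦ ?_
        rw [Finset.sum_mul]
    _ ≤ (SP ^ 2 + 1) * (divWeight n * (2 * (1 + Real.log Y) ^ 2) * br) :=
        mul_le_mul_of_nonneg_right (by nlinarith [sq_nonneg SP])
          (mul_nonneg (mul_nonneg hD (by positivity)) hbr0)
    _ = divWeight n * (2 * (1 + Real.log Y) ^ 2) *
          (C₁ * (SP ^ 2 + 1) * Real.sqrt (2 * ((d : ℝ) ^ 2 / Q ^ 2) * K₁ * Y) +
            2 * (C₂ * (SP ^ 2 + 1) / (1 + Real.log K₁) ^ 12) * G) := by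
        rw [hbr]; ring

end Summit.Parity.GeneralizedHardyLittlewood.Theorems.MomentsBeyondDiagonal.DiagCorner

end
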